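/-
Copyright (c) 2026 the pub-hodgecm-mathlib formalisation cell (harness21).  Prover seat hodgecm-mathlib-LH4-p09 (g8), req620 Track A «(D-RAM) FOUR-FRAME» squad
(heir LEAD F0P3a-plan (g20) T19-24; dealer LH4-plan (g12) WORD #49 «(L-model-G)»; heir dealer LH4-plan (g13) WORD #58 RULING C (first refusal: labelled κ-counts on the glued strata)).  2026-09-04.
-/
import Summits.HodgeConjecture.HodgeConjecture.Theorems.F0P3cDyRamDiagonalKappaGluedSocket        -- ★ κG1 socket p856706 (LH4-p08 (g3)): `finsum_kappaCount_mul_stabiliserWeight_hasAxis_G1`; brings ★ `KappaGluedDecomposition` (κG-C1), ★ κG-A1 `kappaCount_mapGL_diagGLUnits`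
import Summits.HodgeConjecture.HodgeConjecture.Theorems.F0P3cDyRamLabelledKappaSplitStrata       -- ★ (L2b-κS) (F0P3a-p01 (g36)): `finsum_mem_sep_and_eq_ite_of_forall_iff` (the shared skeleton shape)
import Summits.HodgeConjecture.HodgeConjecture.Theorems.F0P3cDyRamLabelledGluedStratumRead      -- ★ p859257 (this seat): `latticeInLevel_diagonal_latt_G1_iff_of_ne`
import Summits.HodgeConjecture.HodgeConjecture.Theorems.F0P3cDyRamDiagonalOrbitCountLabelled    -- ★ p858820 (this seat): `latticeInLevel_mapGL_diagGLUnits_iff` (the token is `𝒯`-invariant)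
import HarnessLib

/-!
# (D-RAM) four-frame, STAGE 1b — (S2b-κS) organs: the LABELLED κ-COUNT on the glued stratum `G1 (2ρ, 2ρ+s, 2ρ+s)` — the generic `𝒯`-invariant-label
# decomposition engine (labelled twin of ★ κG-C1) and the two-token socket OFF the glue loci (labelled twin of ★ κG1 p856706)

Helper brick for dealer LH4-plan (g13) WORD #58 RULING C («(S2b-κS) skeleton … sub-bricks: LH4-p09 (g8) FIRST REFUSAL on the glued + core-hanging strata»): `Theorems/`
only, statement-first, ★-only imports, lane `--supports stmt-HodgeConjecture-24833 --as helper`; it PAYS NO tier-0 row (count-neutral).  ONE SKELETON SHAPE with ★ (L2b-κS)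
`F0P3cDyRamLabelledKappaSplitStrata` (F0P3a-p01 (g36)): binders `(i) (ℓ₁ ℓ₂) (e₁ e₂)`, summation set `{M | M ∈ stratum … ∧ (LatticeInLevel ϖ ℓ₁ (diag e₁) M ∧
LatticeInLevel ϖ ℓ₂ (diag e₂) M)}`, value `if [reads₁ ∧ reads₂] then ★-socket value else 0`.

* §1 ENGINE **`finsum_kappaCount_mul_stabiliserWeight_glued_sep_eq`** — for ANY label `L` invariant under the unit torus (`L(diag(u)·M) ↔ L(M)`), any unit diagonal
  `T`, any complete irredundant representative system `R` (★ (iv-c)) and reference frames `V₀ g = V(1,1,g)`: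
  `Σᶠ_{M ∈ glued stable dualisable family, L M} κᵢ(M)·w(M) = q^{2ρ+2t−⌈(ρ+2t)∕2⌉} · Σ_{g ∈ R, T·latt V₀ g = latt V₀ g ∧ L(latt V₀ g)} κᵢ(latt V₀ g)` — ★ κG-C1
  `finsum_kappaCount_mul_stabiliserWeight_glued_eq` VERBATIM with the index filter shrunk by `L` (stability AND the label are orbit constants: ★ (O2a)
  `mapGL_mapGL_diagGLUnits_eq_iff`, hypothesis `hL`; `κᵢ`, `w` orbit constants: ★ κG-A1, ★ B5 (iii)).  The diagonal level token is such an `L` (★ p858820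
  `latticeInLevel_mapGL_diagGLUnits_iff`), and so is any conjunction of tokens (§1 `levelsLabel_invariant`).
* §2 SOCKET **`finsum_kappaCount_mul_stabiliserWeight_G1_sep_two_of_ne`** — both tokens OFF their glue loci (`|eⱼ₂ − eⱼ₁| ≠ |eⱼ₂ − eⱼ₀|·|ϖ|^s`): the label-cut
  κ-weighted G1 sum is `[reads₁ ∧ reads₂] · (★ κG1 value at the glue witness f₀)` — reads = ★ p859257 `latticeInLevel_diagonal_latt_G1_iff_of_ne`.
The on-locus organs (model tokens `D₁` on the glue foot, `D₂` in the tube; ★ `sum_kappaCount_glued_rep_subBall` over the token ball via §1) are the next file.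

HONEST LABEL: helper organs for a HYPOTHESIS of p12's ★ p859650 (`hTrunk`); STAGE-1b tier-0 rows T₊∕T₋∕regular and the six ED. 5 stubs stay OPEN; HC_CM is proved only
modulo the 7 printed citations (2 remaining named inputs: hLiu418 = `stmt-HodgeConjecture-24832`, h413 = `stmt-HodgeConjecture-24833`) until rung 0 closes.

## References
* [Kottwitz1986BaseChangeUnits] R. E. Kottwitz, *Base change for unit elements of Hecke algebras*, Compositio Math. 60 (1986), §1 pp. 240–241 (κ-orbital integrals of units as signed lattice counts modulo the torus).
* [LanglandsShelstad1987] R. P. Langlands, D. Shelstad, *On the definition of transfer factors*, Math. Ann. 278 (1987), §3 (κ as a character).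
* [Rogawski1990] J. D. Rogawski, *Automorphic Representations of Unitary Groups in Three Variables*, Ann. of Math. Stud. 123 (1990), §4.9 Prop. 4.9.1 (a) p. 55.
-/

set_option autoImplicit false

noncomputable section

namespace Summit.HodgeConjecture.HodgeConjecture.Cruxes.H413.F0P3cDyRamLabelledKappaGluedStratum

open Matrix WithZero
open Literature.NumberTheory.Automorphic Literature.NumberTheory.Automorphic.HermitianLattice
open Literature.NumberTheory.Automorphic.UnitaryLatticeTree Literature.NumberTheory.Automorphic.UnitaryThreeFourFrame
open Literature.NumberTheory.LocalFields.WildQuadraticDatum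
open Summit.HodgeConjecture.HodgeConjecture.Cruxes.H413.F0P3cDyRamDiagonalTorusDefs
open Summit.HodgeConjecture.HodgeConjecture.Cruxes.H413.F0P3cDyRamDiagonalStrataDefs
open Summit.HodgeConjecture.HodgeConjecture.Cruxes.H413.F0P3cDyRamDiagonalKappaCountDefs
open Summit.HodgeConjecture.HodgeConjecture.Cruxes.H413.F0P3cDyRamDiagonalKappaGluedDecomposition (orbit_mass_eq_pow)
open Summit.HodgeConjecture.HodgeConjecture.Cruxes.H413.F0P3cDyRamDiagonalKappaGluedClassForm (kappaCount_mapGL_diagGLUnits)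
open Summit.HodgeConjecture.HodgeConjecture.Cruxes.H413.F0P3cDyRamDiagonalKappaGluedSocket (finsum_kappaCount_mul_stabiliserWeight_hasAxis_G1)
open Summit.HodgeConjecture.HodgeConjecture.Cruxes.H413.F0P3cDyRamDiagonalGluedTorusOrbits
open Summit.HodgeConjecture.HodgeConjecture.Cruxes.H413.F0P3cDyRamDiagonalGluedStabiliserIndex (stabiliserWeight_latt_glued_tube_eq ne_zero_and_v_lt_one_of_v_eq_exp)
open Summit.HodgeConjecture.HodgeConjecture.Cruxes.H413.F0P3cDyRamDiagonalGluedStabiliserIndexFull (ncard_unitTorus_orbit_latt_glued_eq)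
open Summit.HodgeConjecture.HodgeConjecture.Cruxes.H413.F0P3cDyRamDiagonalGluedStratum (stratum_G1_eq)
open Summit.HodgeConjecture.HodgeConjecture.Cruxes.H413.F0P3cDyRamDiagonalPairReindex (mapGL_mapGL_diagGLUnits_eq_iff)
open Summit.HodgeConjecture.HodgeConjecture.Cruxes.H413.F0P3cDyRamDiagonalStratumTools (finsum_mem_eq_ncard_mul stabiliserWeight_mapGL_diagGLUnits)
open Summit.HodgeConjecture.HodgeConjecture.Cruxes.H413.F0P3cDyRamFourFrameCensusDefs
open Summit.HodgeConjecture.HodgeConjecture.Cruxes.H413.F0P3cDyRamDiagonalOrbitCountLabelled (latticeInLevel_mapGL_diagGLUnits_iff)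
open Summit.HodgeConjecture.HodgeConjecture.Cruxes.H413.F0P3cDyRamLabelledSplitStrata (finsum_mem_sep_eq_ite_of_forall_iff)
open Summit.HodgeConjecture.HodgeConjecture.Cruxes.H413.F0P3cDyRamLabelledKappaSplitStrata (finsum_mem_sep_and_eq_ite_of_forall_iff)
open Summit.HodgeConjecture.HodgeConjecture.Cruxes.H413.F0P3cDyRamLabelledGluedStratumRead (latticeInLevel_diagonal_latt_G1_iff_of_ne)
open scoped Valued WithZero Matrix MatrixGroups

/-! ## §1  The engine: the κ-census of the glued stable dualisable family cut by a `𝒯`-invariant label -/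

section Engine

variable {K : Type} [Field K] [Valued K ℤᵐ⁰]

/-- The two-token levels label `diag(e₁)M ⊆ ϖ^{ℓ₁}M ∧ diag(e₂)M ⊆ ϖ^{ℓ₂}M` is invariant under the unit torus (★ p858820). [cite: Kottwitz1986BaseChangeUnits, §1 pp. 240–241] -/
theorem levelsLabel_invariant (ϖ : K) (ℓ₁ ℓ₂ : ℕ) (e₁ e₂ : Fin 3 → K) (u : Fin 3 → Kˣ) (M : Submodule 𝒪[K] (Fin 3 → K)) :
    (LatticeInLevel ϖ ℓ₁ (Matrix.diagonal e₁) (mapGL (diagGLUnits u) M) ∧ LatticeInLevel ϖ ℓ₂ (Matrix.diagonal e₂) (mapGL (diagGLUnits u) M)) ↔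
      (LatticeInLevel ϖ ℓ₁ (Matrix.diagonal e₁) M ∧ LatticeInLevel ϖ ℓ₂ (Matrix.diagonal e₂) M) := by
  rw [latticeInLevel_mapGL_diagGLUnits_iff, latticeInLevel_mapGL_diagGLUnits_iff]

open Classical in
/-- **ENGINE — THE κ-CENSUS OF THE GLUED STABLE DUALISABLE FAMILY CUT BY A `𝒯`-INVARIANT LABEL, BY CLASSES** (labelled twin of ★ κG-C1
`finsum_kappaCount_mul_stabiliserWeight_glued_eq`): for `T = diag(s)` a unit diagonal (no regime assumption), ramified quadratic letters, the trace bound, `ρ, t ≥ 1`, a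
complete irredundant system `R` of the fixed elements of valuation `|ϖ|^{2t}` modulo `𝔭^{ρ+2t}`, reference frames `V₀ g = V(1,1,g)`, and ANY predicate `L` on lattices
invariant under the unit torus:
`Σᶠ_{M ∈ {latt V(x,ζ,y″) : T·M = M, dualisable} with L M} κᵢ(M)·w(M) = q^{2ρ+2t−⌈(ρ+2t)∕2⌉} · Σ_{g ∈ R, T·latt V₀ g = latt V₀ g ∧ L(latt V₀ g)} κᵢ(latt V₀ g)` — the family is
the disjoint union of the orbits of the representatives (★ (iv-a)); stability (★ (O2a)) and the label (`hL`) are orbit constants, as are `κᵢ` (★ κG-A1) and `w` (★ B5 (iii)).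
[cite: Kottwitz1986BaseChangeUnits, §1 pp. 240–241] [cite: LanglandsShelstad1987, §3] [cite: Rogawski1990, §4.9 Prop. 4.9.1 (a) p. 55] -/
theorem finsum_kappaCount_mul_stabiliserWeight_glued_sep_eq {σ : K →+* K} (hσ : ∀ a, σ (σ a) = a) (hvσ : ∀ a, Valued.v (σ a) = Valued.v a)
    (hfix : ∀ x : K, σ x = x → x ≠ 0 → ∃ n : ℤ, Valued.v x = exp (2 * n)) {ϖ : K} (hϖ : Valued.v ϖ = exp (-1 : ℤ))
    {d : ℕ} (hd : Valued.v (ϖ - σ ϖ) = Valued.v ϖ ^ d) [Finite 𝓀[K]] (hTr : ∀ a : K, Valued.v (a + σ a) ≤ Valued.v ϖ * Valued.v a)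
    {s : Fin 3 → K} (T : GL (Fin 3) K) (hT : (T : Matrix (Fin 3) (Fin 3) K) = Matrix.diagonal s)
    (ρ t : ℕ) (hρ : 1 ≤ ρ) (ht : 1 ≤ t) (R : Finset K) (hR1 : ∀ g ∈ R, σ g = g ∧ Valued.v g = Valued.v ϖ ^ (2 * t))
    (hR2 : ∀ f : K, σ f = f → Valued.v f = Valued.v ϖ ^ (2 * t) → ∃ g ∈ R, Valued.v (f - g) ≤ Valued.v ϖ ^ (ρ + 2 * t))
    (hR3 : ∀ g ∈ R, ∀ g' ∈ R, Valued.v (g - g') ≤ Valued.v ϖ ^ (ρ + 2 * t) → g = g')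
    (V₀ : K → GL (Fin 3) K) (hV₀ : ∀ g, (V₀ g : Matrix (Fin 3) (Fin 3) K) = !![1, 0, 0; 1, ϖ ^ ρ, 0; 1 * 1 + g, ϖ ^ ρ * 1, ϖ ^ (2 * ρ + 2 * t)]) (i : Fin 3)
    (L : Submodule 𝒪[K] (Fin 3 → K) → Prop) (hL : ∀ u : Fin 3 → Kˣ, u ∈ unitTorus K 3 → ∀ M : Submodule 𝒪[K] (Fin 3 → K), L (mapGL (diagGLUnits u) M) ↔ L M) :
    ∑ᶠ M ∈ {M | M ∈ {M : Submodule 𝒪[K] (Fin 3 → K) | ∃ x ζ y'' : K, Valued.v x = 1 ∧ Valued.v ζ = 1 ∧ Valued.v y'' = Valued.v ϖ ^ (2 * t) ∧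
        M = latt (!![1, 0, 0; x, ϖ ^ ρ, 0; x * ζ + y'', ϖ ^ ρ * ζ, ϖ ^ (2 * ρ + 2 * t)] : Matrix (Fin 3) (Fin 3) K) ∧ mapGL T M = M ∧ IsDualisableLattice σ ϖ M} ∧ L M},
        (kappaCount σ ϖ 0 i M : ℚ) * stabiliserWeight σ M =
      (Nat.card 𝓀[K] : ℚ) ^ (2 * ρ + 2 * t - (ρ + 2 * t + 1) / 2) *
        ∑ g ∈ R.filter (fun g => mapGL T (latt (V₀ g : Matrix (Fin 3) (Fin 3) K)) = latt (V₀ g : Matrix (Fin 3) (Fin 3) K) ∧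
            L (latt (V₀ g : Matrix (Fin 3) (Fin 3) K))),
          (kappaCount σ ϖ 0 i (latt (V₀ g : Matrix (Fin 3) (Fin 3) K)) : ℚ) := by
  obtain ⟨hϖ0, hϖ1⟩ := ne_zero_and_v_lt_one_of_v_eq_exp hϖ
  set Orb : K → Set (Submodule 𝒪[K] (Fin 3 → K)) := fun g => {M | ∃ u ∈ unitTorus K 3, M = mapGL (diagGLUnits u) (latt (V₀ g : Matrix (Fin 3) (Fin 3) K))}
    with hOrb
  set R' : Finset K := R.filter (fun g => mapGL T (latt (V₀ g : Matrix (Fin 3) (Fin 3) K)) = latt (V₀ g : Matrix (Fin 3) (Fin 3) K) ∧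
    L (latt (V₀ g : Matrix (Fin 3) (Fin 3) K))) with hR'
  have hvg : ∀ g ∈ R, Valued.v g < 1 := fun g hg => by
    rw [(hR1 g hg).2]; exact pow_lt_one₀ zero_le hϖ1 (by omega)
  have hlt : Valued.v ϖ ^ (ρ + 2 * t) < Valued.v ϖ ^ (2 * t) := by
    rw [pow_add, mul_comm]
    exact mul_lt_of_lt_one_right (pow_pos ((Valuation.pos_iff _).2 hϖ0) _) (pow_lt_one₀ zero_le hϖ1 (by omega))
  have h11 : Valued.v (1 : K) = 1 := map_one _
  -- the set identity: the label-cut family is the union of the orbits of the STABLE, LABELLED representatives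
  have hset : {M | M ∈ {M : Submodule 𝒪[K] (Fin 3 → K) | ∃ x ζ y'' : K, Valued.v x = 1 ∧ Valued.v ζ = 1 ∧ Valued.v y'' = Valued.v ϖ ^ (2 * t) ∧
        M = latt (!![1, 0, 0; x, ϖ ^ ρ, 0; x * ζ + y'', ϖ ^ ρ * ζ, ϖ ^ (2 * ρ + 2 * t)] : Matrix (Fin 3) (Fin 3) K) ∧ mapGL T M = M ∧
        IsDualisableLattice σ ϖ M} ∧ L M} = ⋃ g ∈ (R' : Set K), Orb g := by
    ext M
    simp only [Set.mem_setOf_eq, Set.mem_iUnion, hOrb, hR', Finset.coe_filter, exists_prop]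
    constructor
    · rintro ⟨⟨x, ζ, y'', hx, hζ, hy'', rfl, hstab, hdual⟩, hLM⟩
      obtain ⟨V, hV⟩ := exists_gl_coe_eq_glued x ζ y'' (pow_ne_zero ρ hϖ0) (pow_ne_zero _ hϖ0)
      rw [← hV] at hdual
      obtain ⟨f, hσf, hκf⟩ := (isDualisableLattice_latt_glued_iff_exists_fixed_kappa hσ hvσ hϖ0 hϖ1 hTr ρ t hρ ht hx hζ hy'' V hV).1 hdual
      have hvκ : Valued.v (y'' / (x * ζ)) = Valued.v ϖ ^ (2 * t) := by rw [map_div₀, map_mul, hx, hζ, mul_one, div_one, hy'']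
      have hvf : Valued.v f = Valued.v ϖ ^ (2 * t) := by
        have h := Valuation.map_sub_eq_of_lt_left Valued.v (hvκ ▸ hκf.trans_lt hlt : Valued.v (y'' / (x * ζ) - f) < Valued.v (y'' / (x * ζ)))
        rw [← hvκ, ← h, sub_sub_cancel]
      obtain ⟨g, hg, hfg⟩ := hR2 f hσf hvf
      have hκg : Valued.v (y'' / (x * ζ) - g) ≤ Valued.v ϖ ^ (ρ + 2 * t) := by
        rw [show y'' / (x * ζ) - g = (y'' / (x * ζ) - f) + (f - g) by ring]
        exact Valuation.map_add_le _ hκf hfg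
      obtain ⟨u, hu, hM⟩ := exists_mem_unitTorus_latt_glued_eq_mapGL hϖ0 ρ t hx hζ hy'' ht hϖ1 (hvg g hg) hκg (V₀ g) (hV₀ g)
      refine ⟨g, ⟨hg, ?_, ?_⟩, u, hu, hM⟩
      · rw [hM] at hstab
        exact (mapGL_mapGL_diagGLUnits_eq_iff u T hT _).1 hstab
      · rw [hM] at hLM
        exact (hL u hu _).1 hLM
    · rintro ⟨g, ⟨hg, hgst, hgL⟩, u, hu, rfl⟩
      obtain ⟨x', ζ', y₁, hx', hζ', hy₁, hκ, hM⟩ := exists_glued_of_mem_orbit u hu g (ϖ ^ ρ) (ϖ ^ (2 * ρ + 2 * t)) (V₀ g) (hV₀ g)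
      have hy₁' : Valued.v y₁ = Valued.v ϖ ^ (2 * t) := by rw [hy₁, (hR1 g hg).2]
      obtain ⟨V, hV⟩ := exists_gl_coe_eq_glued x' ζ' y₁ (pow_ne_zero ρ hϖ0) (pow_ne_zero _ hϖ0)
      refine ⟨⟨x', ζ', y₁, hx', hζ', hy₁', hM, ?_, ?_⟩, (hL u hu _).2 hgL⟩
      · exact (mapGL_mapGL_diagGLUnits_eq_iff u T hT _).2 hgst
      · rw [hM, ← hV]
        exact (isDualisableLattice_latt_glued_iff_exists_fixed_kappa hσ hvσ hϖ0 hϖ1 hTr ρ t hρ ht hx' hζ' hy₁' V hV).2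
          ⟨g, (hR1 g hg).1, by rw [hκ, sub_self, map_zero]; exact zero_le⟩
  -- pairwise disjoint orbits
  have hdisj : (R' : Set K).PairwiseDisjoint Orb := by
    intro g hg g' hg' hne
    have hgR : g ∈ R := (Finset.mem_filter.1 hg).1
    have hg'R : g' ∈ R := (Finset.mem_filter.1 hg').1
    rw [Function.onFun, Set.disjoint_left]
    intro M hM hM'
    apply hne
    simp only [hOrb, Set.mem_setOf_eq] at hM hM'
    obtain ⟨u, hu, rfl⟩ := hM
    obtain ⟨u', hu', hMM⟩ := hM'
    obtain ⟨x, ζ, y, hx, hζ, hy, hκ, h1⟩ := exists_glued_of_mem_orbit u hu g (ϖ ^ ρ) (ϖ ^ (2 * ρ + 2 * t)) (V₀ g) (hV₀ g)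
    obtain ⟨x', ζ', y', hx', hζ', -, hκ', h2⟩ := exists_glued_of_mem_orbit u' hu' g' (ϖ ^ ρ) (ϖ ^ (2 * ρ + 2 * t)) (V₀ g') (hV₀ g')
    have hyv : Valued.v y = Valued.v ϖ ^ (2 * t) := by rw [hy, (hR1 g hgR).2]
    have hv := v_kappa_sub_le_of_latt_glued_eq hϖ0 hϖ1.le ρ t hx hζ hyv hx' hζ' (h1.symm.trans (hMM.trans h2))
    rw [hκ, hκ'] at hv
    exact hR3 g hgR g' hg'R hv
  -- orbit sizes, the weight and the κ-count along an orbit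
  have hN : ∀ g ∈ (R' : Set K), (Orb g).ncard = ((Nat.card 𝓀[K] - 1) * Nat.card 𝓀[K] ^ (ρ + 2 * t - 1)) * ((Nat.card 𝓀[K] - 1) * Nat.card 𝓀[K] ^ (2 * ρ - 1)) :=
    fun g hg => ncard_unitTorus_orbit_latt_glued_eq hϖ hρ (2 * t) h11 h11 (by rw [(hR1 g (Finset.mem_filter.1 hg).1).2]) (V₀ g) (by rw [hV₀ g])
  have hq : 1 < Nat.card 𝓀[K] := Finite.one_lt_card
  have hN0 : ((Nat.card 𝓀[K] - 1) * Nat.card 𝓀[K] ^ (ρ + 2 * t - 1)) * ((Nat.card 𝓀[K] - 1) * Nat.card 𝓀[K] ^ (2 * ρ - 1)) ≠ 0 :=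
    mul_ne_zero (mul_ne_zero (by omega) (pow_ne_zero _ (by omega))) (mul_ne_zero (by omega) (pow_ne_zero _ (by omega)))
  have hfinOrb : ∀ g ∈ (R' : Set K), (Orb g).Finite := fun g hg => Set.finite_of_ncard_ne_zero (by rw [hN g hg]; exact hN0)
  have hw : ∀ g ∈ (R' : Set K), ∀ M ∈ Orb g, (kappaCount σ ϖ 0 i M : ℚ) * stabiliserWeight σ M =
      (kappaCount σ ϖ 0 i (latt (V₀ g : Matrix (Fin 3) (Fin 3) K)) : ℚ) *
        ((((Nat.card 𝓀[K] - 1) * Nat.card 𝓀[K] ^ ((ρ + 2 * t + 1) / 2 - 1)) * ((Nat.card 𝓀[K] - 1) * Nat.card 𝓀[K] ^ (ρ - 1)) : ℕ) : ℚ)⁻¹ := by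
    rintro g hg M ⟨u, -, rfl⟩
    have hgR : g ∈ R := (Finset.mem_filter.1 hg).1
    rw [kappaCount_mapGL_diagGLUnits hσ, stabiliserWeight_mapGL_diagGLUnits,
      stabiliserWeight_latt_glued_tube_eq hσ hvσ hfix hϖ hd hρ t h11 h11 (hR1 g hgR).2 (V₀ g) (hV₀ g) (hR1 g hgR).1
        (by rw [map_one, (hR1 g hgR).1, one_mul, sub_self, map_zero]; exact zero_le)]
  have hR'fin : (R' : Set K).Finite := R'.finite_toSet
  rw [hset, finsum_mem_biUnion hdisj hR'fin hfinOrb,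
    finsum_mem_congr rfl (fun g hg => finsum_mem_eq_ncard_mul (hfinOrb g hg) _ _ (hw g hg)),
    finsum_mem_congr rfl (fun g hg => by rw [hN g hg]), finsum_mem_coe_finset, ← orbit_mass_eq_pow hq hρ t, Finset.mul_sum]
  refine Finset.sum_congr rfl fun g _ => ?_
  ring

end Engine

/-! ## §2  The two-token socket off the glue loci -/

section Socket

variable {K : Type} [Field K] [Valued K ℤᵐ⁰] [CompleteSpace K] [Fintype 𝓀[K]] {σ : K →+* K} {ϖ : K} {d t : ℕ} {α β : K} {N₀ n₁ n₂ n₃ : ℕ}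
  {T : GL (Fin 3) K}

/-- **SOCKET — THE LABELLED κ-WEIGHTED G1 `(2ρ, 2ρ+s, 2ρ+s)`, BOTH TOKENS OFF THEIR GLUE LOCI** (`ρ, s ≥ 1`; `|eⱼ 2 − eⱼ 1| ≠ |eⱼ 2 − eⱼ 0|·|ϖ|^s` for `j = 1, 2`):
each token is CONSTANT on the stratum (★ p859257 `latticeInLevel_diagonal_latt_G1_iff_of_ne`), so the label-cut κ-weighted sum is the indicator of the two reads times ★ κG1
`finsum_kappaCount_mul_stabiliserWeight_hasAxis_G1` at the glue witness `f₀` (binder verbatim).  Shape = ★ (L2b-κS) `…_T1_sep_two`.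
[cite: Kottwitz1986BaseChangeUnits, §1 pp. 240–241] [cite: LanglandsShelstad1987, §3] [cite: Rogawski1990, §4.9 Prop. 4.9.1 (a) p. 55] -/
theorem finsum_kappaCount_mul_stabiliserWeight_G1_sep_two_of_ne (hD : IsRamifiedQuadraticDatum σ ϖ d t) (h2 : Valued.v (2 : K) < 1)
    (hE : IsElementDatum σ ϖ N₀ α β n₁ n₂ n₃) (hN₀ : d ≤ N₀) (hT : (T : Matrix (Fin 3) (Fin 3) K) = Matrix.diagonal ![α, β, 1])
    (ρ s : ℕ) (hρ : 1 ≤ ρ) (hs : 1 ≤ s) (i : Fin 3) (f₀ : K) (hf₀ : σ f₀ = f₀)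
    (hglue : 2 ∣ s → n₂ = n₃ → n₁ = n₂ + s → n₂ < 2 * ρ → 2 * ρ - n₂ ≤ n₂ - d + 1 → Valued.v (f₀ + (β - 1) / (α - 1)) ≤ Valued.v ϖ ^ (2 * ρ + s - n₂))
    (ℓ₁ ℓ₂ : ℕ) (e₁ e₂ : Fin 3 → K) (hne₁ : Valued.v (e₁ 2 - e₁ 1) ≠ Valued.v (e₁ 2 - e₁ 0) * Valued.v ϖ ^ s)
    (hne₂ : Valued.v (e₂ 2 - e₂ 1) ≠ Valued.v (e₂ 2 - e₂ 0) * Valued.v ϖ ^ s) :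
    ∑ᶠ M ∈ {M | M ∈ stratum σ ϖ T ![2 * ρ, 2 * ρ + s, 2 * ρ + s] ∧
        (LatticeInLevel ϖ ℓ₁ (Matrix.diagonal e₁) M ∧ LatticeInLevel ϖ ℓ₂ (Matrix.diagonal e₂) M)},
        (kappaCount σ ϖ 0 i M : ℚ) * stabiliserWeight σ M =
      if (((Valued.v (e₁ 0) ≤ Valued.v ϖ ^ ℓ₁ ∧ Valued.v (e₁ 1) ≤ Valued.v ϖ ^ ℓ₁ ∧ Valued.v (e₁ 2) ≤ Valued.v ϖ ^ ℓ₁) ∧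
            Valued.v (e₁ 1 - e₁ 0) ≤ Valued.v ϖ ^ (ℓ₁ + ρ) ∧ Valued.v (e₁ 2 - e₁ 1) ≤ Valued.v ϖ ^ (ℓ₁ + ρ + s) ∧
              (Valued.v (e₁ 2 - e₁ 1) ≤ Valued.v ϖ ^ (ℓ₁ + 2 * ρ + s) ∧ Valued.v (e₁ 2 - e₁ 0) * Valued.v ϖ ^ s ≤ Valued.v ϖ ^ (ℓ₁ + 2 * ρ + s))) ∧
          ((Valued.v (e₂ 0) ≤ Valued.v ϖ ^ ℓ₂ ∧ Valued.v (e₂ 1) ≤ Valued.v ϖ ^ ℓ₂ ∧ Valued.v (e₂ 2) ≤ Valued.v ϖ ^ ℓ₂) ∧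
            Valued.v (e₂ 1 - e₂ 0) ≤ Valued.v ϖ ^ (ℓ₂ + ρ) ∧ Valued.v (e₂ 2 - e₂ 1) ≤ Valued.v ϖ ^ (ℓ₂ + ρ + s) ∧
              (Valued.v (e₂ 2 - e₂ 1) ≤ Valued.v ϖ ^ (ℓ₂ + 2 * ρ + s) ∧ Valued.v (e₂ 2 - e₂ 0) * Valued.v ϖ ^ s ≤ Valued.v ϖ ^ (ℓ₂ + 2 * ρ + s)))) then
        ((if 2 ∣ s ∧ 2 * ρ ≤ min n₂ n₃ ∧ 2 * ρ + s ≤ n₁ then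
            (![(normSign σ (-1 : K) : ℚ) * (Fintype.card 𝓀[K] : ℚ) ^ (2 * ρ + s / 2 - 1) *
                ((if 2 * d ≤ s then (Fintype.card 𝓀[K] : ℚ) - 1 else 0) - (if s + 2 = 2 * d then 1 else 0)), 0, 0] : Fin 3 → ℚ) i
          else 0) +
        (if 2 ∣ s ∧ n₂ = n₃ ∧ n₁ = n₂ + s ∧ n₂ < 2 * ρ ∧ 2 * ρ - n₂ ≤ n₂ - d + 1 then
            (![if 2 * d ≤ s + 2 * ((2 * ρ - n₂ + 1) / 2) then (normSign σ (-1 : K) : ℚ) * normSign σ (1 + f₀) else 0,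
               if d ≤ (2 * ρ - n₂ + 1) / 2 then (normSign σ (-1 : K) : ℚ) * normSign σ f₀ * normSign σ (1 + f₀) else 0,
               if d ≤ (2 * ρ - n₂ + 1) / 2 then (normSign σ f₀ : ℚ) else 0] : Fin 3 → ℚ) i *
              (Fintype.card 𝓀[K] : ℚ) ^ (2 * ρ + s / 2 - (2 * ρ - n₂ + 1) / 2)
          else 0))
      else 0 := by
  classical
  have hvσ : ∀ a, Valued.v (σ a) = Valued.v a := hD.2.1
  have hϖ : Valued.v ϖ = exp (-1 : ℤ) := hD.2.2.1
  have hfix : ∀ x : K, σ x = x → x ≠ 0 → ∃ n : ℤ, Valued.v x = exp (2 * n) := hD.2.2.2.1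
  have hϖ0 : ϖ ≠ 0 := (ne_zero_and_v_lt_one_of_v_eq_exp hϖ).1
  rw [finsum_mem_sep_and_eq_ite_of_forall_iff (stratum σ ϖ T ![2 * ρ, 2 * ρ + s, 2 * ρ + s]) _ _ _ _
      (fun M hM => by
        rw [stratum_G1_eq hvσ hfix hϖ T hρ hs] at hM
        obtain ⟨x, ζ, y'', hx, hζ, hy, rfl, -, -⟩ := hM
        exact latticeInLevel_diagonal_latt_G1_iff_of_ne hϖ0 ℓ₁ ρ s e₁ hx hζ hy hne₁)
      (fun M hM => by
        rw [stratum_G1_eq hvσ hfix hϖ T hρ hs] at hM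
        obtain ⟨x, ζ, y'', hx, hζ, hy, rfl, -, -⟩ := hM
        exact latticeInLevel_diagonal_latt_G1_iff_of_ne hϖ0 ℓ₂ ρ s e₂ hx hζ hy hne₂),
    finsum_kappaCount_mul_stabiliserWeight_hasAxis_G1 hD h2 hE hN₀ hT ρ s hρ hs i f₀ hf₀ hglue]

end Socket

end Summit.HodgeConjecture.HodgeConjecture.Cruxes.H413.F0P3cDyRamLabelledKappaGluedStratum

end
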